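import Summits.HubbardSuperconductivity.HubbardSuperconductivity.Theorems.BirGroundStateAverageLRO.Negative.PairingCost
import Literature.MathematicalPhysics.QuantumLattice.FreeFermiGasPairingCostSharp

/-!
# Crux `BirGroundStateAverageLRO` (item `stmt-HubbardSuperconductivity-2079`): the window floor at the QUADRATIC rate

The crux (`Theses.BalabanIR.BirGroundStateAverageLRO`, route BalabanIR, target / rank 0) asks, on a
window of couplings `0 < U₁ < U < U₂`, eventually in even `L`, the ground-state-AVERAGE `d`-wave pair
LRO `c·L⁴·Re tr P ≤ Re tr (P Δ_d† Δ_d)` for the projection `P` onto the ground eigenspace of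
`hubbardTorus 2 L 1 U` in the sector `(2⌊(1-δ)L²/2⌋, S^z = 0)`.

`Negative/PairingCost.lean` derived the UNCONDITIONAL window floor `4·(min(c,1)/48)⁶ ≤ U₁` from the
sextic pairing-cost rate. The rate is now QUADRATIC (`Literature/…/FreeFermiGasPairingCostSharp.lean`,
`freeDWavePairing_costs_energy_sharp_rate`: `d`-wave pair density `a` in a unit vector of
`szSector N 0` costs free kinetic energy `≥ (min(a,1)/8192)²·L²` once `L ≥ ⌈1216/a⌉ + 3` — the
optimal power of the pair-Gram / bathtub method), and every consequence sharpens accordingly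
(negative side only; nothing asserts a Theses decl; every mutated statement is spelled out):

* `avgBound_coupling_floor_sharp` — POINTWISE: the crux's inequality at ONE datum `(δ, U, c, L)` with
  `δ ≥ -1`, `U ≥ 0`, `c > 0`, `L ≥ ⌈1216/c⌉ + 3` forces `(min(c,1)/8192)² ≤ U`; equivalently
  (`avgBound_min_density_one_le_mul_sqrt`) `min(c,1) ≤ 8192·√U`: the ground-state-average `d`-wave
  pair density of the repulsive Hubbard torus is `O(√U)` (was `O(U^{1/6})`).
* `birGroundStateAverageLRO_window_floor_sharp` / `…_witness_floor_sharp` /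
  `…_witness_min_le_mul_sqrt` — every witness `(δ, U₁, U₂, c)` of the crux (indeed of its weakening
  with `0 ≤ U₁`) satisfies `(min(c,1)/8192)² ≤ U₁`, i.e. `min(c,1) ≤ 8192·√U₁`.
* `pairingCostWitnessFloorSharp` — the one-line registered form (stub of crux `stmt-…-2079`).

Regime map for the planners / the standing disprover: an engine for the crux must output a constant
`c(U₁) ≤ 8192 √U₁` (and `≤ 32`, `Disproof.lean` §2); the expected truth is `c(U) ~ e^{-O(1/U)}`-small
(`PerturbativeInvisibilityOfPairing`), which no energy-balance argument with a polynomial kinetic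
budget can reach — the present `√U` is the endpoint of the first-order budget `U·L²`.

Sources: Bardeen–Cooper–Schrieffer, Phys. Rev. 108 (1957) 1175, §II; C. N. Yang, Rev. Mod. Phys. 34
(1962) 694, §3; Tasaki (2020) §2.2 (variational principle). Folklore finite-dimensional statements;
no named facts, no definitions.
-/

noncomputable section

namespace Summit.HubbardSuperconductivity.HubbardSuperconductivity.Theorems.BirGroundStateAverageLRO.Negative

open Matrix Finset Filter
open Literature.Probability.LatticeModels Literature.MathematicalPhysics.QuantumLattice
open Summit.HubbardSuperconductivity.HubbardSuperconductivity.Theorems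
open scoped ComplexOrder

/-- **Pointwise coupling floor, quadratic rate.** If the crux's ground-state-average bound
`c·L⁴·Re tr P ≤ Re tr (P Δ_d†Δ_d)` holds at ONE datum `(δ, U, c, L)` with `δ ≥ -1`, `U ≥ 0`, `c > 0`
and `L ≥ ⌈1216/c⌉ + 3`, then `(min(c,1)/8192)² ≤ U`: a sector ground state carrying the bound
(`exists_groundState_le_of_trace_bound`) has free-energy excess `≤ U·L²`
(`re_free_energy_groundState_le`) and `≥ (min(c,1)/8192)²·L²`
(`freeDWavePairing_costs_energy_sharp_rate`). [folklore] -/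
theorem avgBound_coupling_floor_sharp (L : ℕ) [NeZero L] {δ U c : ℝ} (hδ : -1 ≤ δ) (hU : 0 ≤ U)
    (hc : 0 < c) (hL : ⌈1216 / c⌉₊ + 3 ≤ L)
    (h : let N : ℕ := 2 * ⌊(1 - δ) * (L : ℝ) ^ 2 / 2⌋₊
      let H := hubbardTorus 2 L 1 U
      let S := szSector (Λ := FermionTorus 2 L) N 0
      let E₀ := S ⊓ Module.End.eigenspace (Matrix.toLin' H) ((H.minEnergyOn S : ℝ) : ℂ)
      let P := projMatrix (E₀.map (Fock.toEuclidean (ι := Orb (FermionTorus 2 L)) :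
        Fock (Orb (FermionTorus 2 L)) →ₗ[ℂ] EuclideanSpace ℂ (Finset (Orb (FermionTorus 2 L)))))
      c * (L : ℝ) ^ 4 * P.trace.re ≤
        (P * ((pairField dWaveFormFactor L)ᴴ * pairField dWaveFormFactor L)).trace.re) :
    (min c 1 / 8192) ^ 2 ≤ U := by
  obtain ⟨ψ, hgs, h1, hle⟩ := exists_groundState_le_of_trace_bound L 1 U δ c hδ h
  have hn := NoGo.floor_pairNumber_le δ hδ L
  have hcost := freeDWavePairing_costs_energy_sharp_rate hc hL hgs.1 h1 hle
  have hfree := re_free_energy_groundState_le L 1 U hU hn hgs h1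
  have hL2 : (0 : ℝ) < (L : ℝ) ^ 2 := by
    have : (0 : ℝ) < (L : ℝ) := by exact_mod_cast Nat.pos_of_ne_zero (NeZero.ne L)
    positivity
  have hmul : (min c 1 / 8192) ^ 2 * (L : ℝ) ^ 2 ≤ U * (L : ℝ) ^ 2 := by linarith
  exact le_of_mul_le_mul_right hmul hL2

/-- **The ground-state-average `d`-wave pair density is `O(√U)`.** Under the hypotheses of
`avgBound_coupling_floor_sharp` (the crux's inequality at one datum `(δ, U, c, L)`, `δ ≥ -1`,
`U ≥ 0`, `c > 0`, `L ≥ ⌈1216/c⌉ + 3`): `min(c,1) ≤ 8192·√U`. [folklore] -/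
theorem avgBound_min_density_one_le_mul_sqrt (L : ℕ) [NeZero L] {δ U c : ℝ} (hδ : -1 ≤ δ)
    (hU : 0 ≤ U) (hc : 0 < c) (hL : ⌈1216 / c⌉₊ + 3 ≤ L)
    (h : let N : ℕ := 2 * ⌊(1 - δ) * (L : ℝ) ^ 2 / 2⌋₊
      let H := hubbardTorus 2 L 1 U
      let S := szSector (Λ := FermionTorus 2 L) N 0
      let E₀ := S ⊓ Module.End.eigenspace (Matrix.toLin' H) ((H.minEnergyOn S : ℝ) : ℂ)
      let P := projMatrix (E₀.map (Fock.toEuclidean (ι := Orb (FermionTorus 2 L)) :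
        Fock (Orb (FermionTorus 2 L)) →ₗ[ℂ] EuclideanSpace ℂ (Finset (Orb (FermionTorus 2 L)))))
      c * (L : ℝ) ^ 4 * P.trace.re ≤
        (P * ((pairField dWaveFormFactor L)ᴴ * pairField dWaveFormFactor L)).trace.re) :
    min c 1 ≤ 8192 * Real.sqrt U := by
  have hfl := avgBound_coupling_floor_sharp L hδ hU hc hL h
  have h0 : 0 ≤ min c 1 / 8192 := by
    have := lt_min hc one_pos
    positivity
  have hs := Real.sqrt_le_sqrt hfl
  rw [Real.sqrt_sq h0] at hs
  linarith

/-- **Window floor for `BirGroundStateAverageLRO`, quadratic rate.** If the crux's average bound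
with constant `c > 0` holds eventually in even `L` at every coupling of an interval `(U₁, U₂)`,
`0 ≤ U₁ < U₂` (`δ ∈ (0,1/2)`), then `(min(c,1)/8192)² ≤ U₁`
(`LoadBearing.birGroundStateAverageLRO_window_floor` with the quadratic energy-cost rate).
[folklore] -/
theorem birGroundStateAverageLRO_window_floor_sharp {δ U₁ U₂ c : ℝ}
    (hδ : δ ∈ Set.Ioo (0:ℝ) (1/2)) (hU₁ : 0 ≤ U₁) (hU : U₁ < U₂) (hc : 0 < c)
    (h : ∀ U ∈ Set.Ioo U₁ U₂, ∃ L₀ : ℕ, ∀ (L : ℕ) [NeZero L], L₀ ≤ L → Even L →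
      let N : ℕ := 2 * ⌊(1 - δ) * (L : ℝ) ^ 2 / 2⌋₊
      let H := hubbardTorus 2 L 1 U
      let S := szSector (Λ := FermionTorus 2 L) N 0
      let E₀ := S ⊓ Module.End.eigenspace (Matrix.toLin' H) ((H.minEnergyOn S : ℝ) : ℂ)
      let P := projMatrix (E₀.map (Fock.toEuclidean (ι := Orb (FermionTorus 2 L)) :
        Fock (Orb (FermionTorus 2 L)) →ₗ[ℂ] EuclideanSpace ℂ (Finset (Orb (FermionTorus 2 L)))))
      c * (L : ℝ) ^ 4 * P.trace.re ≤
        (P * ((pairField dWaveFormFactor L)ᴴ * pairField dWaveFormFactor L)).trace.re) :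
    (min c 1 / 8192) ^ 2 ≤ U₁ :=
  birGroundStateAverageLRO_window_floor hδ hU₁ hU h (η := (min c 1 / 8192) ^ 2)
    (L₁ := ⌈1216 / c⌉₊ + 3)
    (fun _ _ hL _ _ hS h1 hle => freeDWavePairing_costs_energy_sharp_rate hc hL hS h1 hle)

/-- **Corollary for the crux itself, quadratic rate.** Any witness `(δ, U₁, U₂, c)` of
`BirGroundStateAverageLRO` (with its `0 < U₁`) has `(min(c,1)/8192)² ≤ U₁`. [folklore] -/
theorem birGroundStateAverageLRO_witness_floor_sharp {δ U₁ U₂ c : ℝ}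
    (hδ : δ ∈ Set.Ioo (0:ℝ) (1/2)) (hU₁ : 0 < U₁) (hU : U₁ < U₂) (hc : 0 < c)
    (h : ∀ U ∈ Set.Ioo U₁ U₂, ∃ L₀ : ℕ, ∀ (L : ℕ) [NeZero L], L₀ ≤ L → Even L →
      let N : ℕ := 2 * ⌊(1 - δ) * (L : ℝ) ^ 2 / 2⌋₊
      let H := hubbardTorus 2 L 1 U
      let S := szSector (Λ := FermionTorus 2 L) N 0
      let E₀ := S ⊓ Module.End.eigenspace (Matrix.toLin' H) ((H.minEnergyOn S : ℝ) : ℂ)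
      let P := projMatrix (E₀.map (Fock.toEuclidean (ι := Orb (FermionTorus 2 L)) :
        Fock (Orb (FermionTorus 2 L)) →ₗ[ℂ] EuclideanSpace ℂ (Finset (Orb (FermionTorus 2 L)))))
      c * (L : ℝ) ^ 4 * P.trace.re ≤
        (P * ((pairField dWaveFormFactor L)ᴴ * pairField dWaveFormFactor L)).trace.re) :
    (min c 1 / 8192) ^ 2 ≤ U₁ :=
  birGroundStateAverageLRO_window_floor_sharp hδ hU₁.le hU hc h

/-- **Every witness of the crux has `min(c,1) ≤ 8192·√U₁`.** The admissible LRO constant of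
`BirGroundStateAverageLRO` is `O(√U₁)` in the lower edge of its window. [folklore] -/
theorem birGroundStateAverageLRO_witness_min_le_mul_sqrt {δ U₁ U₂ c : ℝ}
    (hδ : δ ∈ Set.Ioo (0:ℝ) (1/2)) (hU₁ : 0 < U₁) (hU : U₁ < U₂) (hc : 0 < c)
    (h : ∀ U ∈ Set.Ioo U₁ U₂, ∃ L₀ : ℕ, ∀ (L : ℕ) [NeZero L], L₀ ≤ L → Even L →
      let N : ℕ := 2 * ⌊(1 - δ) * (L : ℝ) ^ 2 / 2⌋₊
      let H := hubbardTorus 2 L 1 U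
      let S := szSector (Λ := FermionTorus 2 L) N 0
      let E₀ := S ⊓ Module.End.eigenspace (Matrix.toLin' H) ((H.minEnergyOn S : ℝ) : ℂ)
      let P := projMatrix (E₀.map (Fock.toEuclidean (ι := Orb (FermionTorus 2 L)) :
        Fock (Orb (FermionTorus 2 L)) →ₗ[ℂ] EuclideanSpace ℂ (Finset (Orb (FermionTorus 2 L)))))
      c * (L : ℝ) ^ 4 * P.trace.re ≤
        (P * ((pairField dWaveFormFactor L)ᴴ * pairField dWaveFormFactor L)).trace.re) :
    min c 1 ≤ 8192 * Real.sqrt U₁ := by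
  have hfl := birGroundStateAverageLRO_witness_floor_sharp hδ hU₁ hU hc h
  have h0 : 0 ≤ min c 1 / 8192 := by
    have := lt_min hc one_pos
    positivity
  have hs := Real.sqrt_le_sqrt hfl
  rw [Real.sqrt_sq h0] at hs
  linarith

/-- **Registered stub `pairingCostWitnessFloorSharp` (crux `stmt-HubbardSuperconductivity-2079`).**
Every witness `(δ, U₁, U₂, c)` of the crux satisfies the UNCONDITIONAL coupling floor
`(min(c,1)/8192)² ≤ U₁` (`birGroundStateAverageLRO_witness_floor_sharp`, one-line registered form).
[folklore] -/
theorem pairingCostWitnessFloorSharp : ∀ (δ U₁ U₂ c : ℝ), δ ∈ Set.Ioo (0:ℝ) (1/2) → 0 < U₁ → U₁ < U₂ → 0 < c → (∀ U ∈ Set.Ioo U₁ U₂, ∃ L₀ : ℕ, ∀ (L : ℕ) [NeZero L], L₀ ≤ L → Even L → let N : ℕ := 2 * ⌊(1 - δ) * (L : ℝ) ^ 2 / 2⌋₊; let H := Literature.MathematicalPhysics.QuantumLattice.hubbardTorus 2 L 1 U; let S := Literature.MathematicalPhysics.QuantumLattice.szSector (Λ := Literature.MathematicalPhysics.QuantumLattice.FermionTorus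 2 L) N 0; let E₀ := S ⊓ Module.End.eigenspace (Matrix.toLin' H) ((H.minEnergyOn S : ℝ) : ℂ); let P := Literature.MathematicalPhysics.QuantumLattice.projMatrix (E₀.map (Literature.MathematicalPhysics.QuantumLattice.Fock.toEuclidean (ι := Literature.MathematicalPhysics.QuantumLattice.Orb (Literature.MathematicalPhysics.QuantumLattice.FermionTorus 2 L)) : Literature.MathematicalPhysics.QuantumLattice.Fock (Literature.MathematicalPhysics.QuantumLattice.Orb (Literature.MathematicalPhysics.QuantumLattice.FermionTorus 2 L)) →ₗ[ℂ] EuclideanSpace ℂ (Finset (Literature.MathematicalPhysics.QuantumLattice.Orb (Literature.MathematicalPhysics.QuantumLattice.FermionTorus 2 L))))); c * (L : ℝ) ^ 4 * P.trace.re ≤ (P * (Matrix.conjTranspose (Literature.MathematicalPhysics.QuantumLattice.pairField Literature.MathematicalPhysics.QuantumLattice.dWaveFormFactor L) * Literature.MathematicalPhysics.QuantumLattice.pairField Literature.MathematicalPhysics.QuantumLattice.dWaveFormFactor L)).trace.re) → (min c 1 / 8192) ^ 2 ≤ U₁ :=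
  fun _ _ _ _ hδ hU₁ hU hc h => birGroundStateAverageLRO_witness_floor_sharp hδ hU₁ hU hc h

end Summit.HubbardSuperconductivity.HubbardSuperconductivity.Theorems.BirGroundStateAverageLRO.Negative
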